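import Literature.MathematicalPhysics.KineticTheory.LanfordReduction
import HarnessLib

/-!
# Lanford's theorem (`lanford`, hilbert6.S02): fact decomposition into its two printed inputs

Topic `MathematicalPhysics/KineticTheory`. FACT-SPLIT file (librarian, mode `fact-decompose`,
2026-08-16) for the XL named fact `Literature.MathematicalPhysics.KineticTheory.lanford`
(`Sweep1.lean`; Lanford 1975, Cercignani–Illner–Pulvirenti 1994 Thm 4.4.1, Gallagher–Saint-Raymond–
Texier 2013 Thm 8), which exhausted its prover budget. The tree already proves
(`LanfordReduction.lean`, `lanford_of_sectorwise_of_termwise`) that `lanford` follows from exactly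
two inputs of the printed proof, each a statement about objects of the tree and neither a rewording
of `lanford`; under D-0026 those inputs could only be carried as hypotheses. This file names them
(D-0014 named facts, `def … : Prop`) so that they can be claimed and proved separately, and records
the PROVED assembly `lanford_holds_of`:

* `lanford_sectorwiseDuhamelFormula` — **(S)** the sectorwise iterated Duhamel formula: for every
  diameter `0 < ε < 1/2`, every Lanford datum `f₀`, every particle number `n`, `s ≤ n` and `t ≥ 0`,
  the `s`-marginal of the `n`-th sector of the grand-canonical Gibbs state `gcInitial … ε μ_ε f₀`
  evolved along the regularised Alexander hard-sphere flow equals, almost everywhere, the finite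
  Duhamel (BBGKY) series of the `n`-sphere hierarchy model `hsHierarchyModel` started from the
  marginals of that sector [CIP 1994, §4.4 eq. (4.7) "for almost all `z^s`", App. 4.A–4.B;
  Illner–Pulvirenti; Spohn, arXiv:math-ph/0605068 Thm 11];
* `lanford_termwiseConvergence` — **(C)** the term-by-term convergence: for `d ≥ 2`, `β₀, C₀ > 0`
  there is `T_c > 0` such that for every Lanford datum, every `ε_k → 0⁺` (`ε_k < 1/2`), all `s, n`,
  every continuous compactly supported velocity observable, every compact set off the position
  diagonal and every `δ > 0`, eventually in `k` the velocity averages of the grand-canonical Duhamel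
  term `Q^{ε_k}_{s,s+n}(t) F_{ε_k}(0)` (`lanfordGCTerm`) and of the Boltzmann Duhamel term
  `Q⁰_{s,s+n}(t) f₀^{⊗(s+n)}` (`boltzmannDuhamelTerm`) differ by at most `δ`, uniformly for
  `t ∈ [0, T_c]` and positions in the compact set [CIP 1994, Thm 4.4.1, proof, Step 1 (pp. 77–86);
  GST 2013, Part III, proof of Thm 8];
* `lanford_holds_of : lanford_sectorwiseDuhamelFormula → lanford_termwiseConvergence → lanford` —
  PROVED (it is `lanford_of_sectorwise_of_termwise`).

Both children are stated verbatim as the hypotheses `hS`, `hconv` of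
`lanford_of_sectorwise_of_termwise`, with the dimension type `d` implicit exactly as in `lanford`.

## References

* C. Cercignani, R. Illner, M. Pulvirenti, *The Mathematical Theory of Dilute Gases*, Applied
  Mathematical Sciences 106, Springer (1994), §4.4 (4.7), Thm 4.4.1 and its proof (Steps 1–4,
  pp. 77–86), App. 4.A–4.B. [CIP1994]
* I. Gallagher, L. Saint-Raymond, B. Texier, *From Newton to Boltzmann: hard spheres and
  short-range potentials*, EMS (2013) = arXiv:1208.5753, Thms 6–8, Ch. 18 §2. [GST2013]
* H. Spohn, *On the integrated form of the BBGKY hierarchy for hard spheres*,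
  arXiv:math-ph/0605068, Thm 11. [Spohn2006]
-/

open MeasureTheory Metric Real Set Filter Topology Function
open scoped ENNReal

namespace Literature.MathematicalPhysics.KineticTheory

noncomputable section

open Literature.Analysis.FluidPDE

variable {d : Type*} [Fintype d]

/-- NAMED FACT **(S) — the sectorwise iterated Duhamel formula for the Gibbs states of Lanford
data** (CIP 1994, §4.4 eq. (4.7): the time-evolved marginals are given "for almost all `z^s`" by
the BBGKY/Duhamel series, App. 4.A–4.B; Spohn 2006 Thm 11). For every `0 < ε < 1/2`, all
`β₀, C₀ > 0`, every Lanford datum `f₀` (`IsLanfordDatum β₀ C₀ f₀`), every `n`, `s ≤ n` and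
`t ≥ 0`: the `s`-marginal of the `n`-th sector of `gcInitial (Torus.geometry d) ε (bgActivity d ε) f₀`
evolved along the regularised Alexander flows `Alexander.regHardSphereFlow` is almost everywhere
equal to the finite Duhamel series `(hsHierarchyModel hε hε' n).seriesFamily n` of the `n`-sphere
hierarchy started from the marginals of that sector. Input (S) of `lanford_of_sectorwise_of_termwise`
(`LanfordReduction.lean`), verbatim. Users take `(h : lanford_sectorwiseDuhamelFormula)`.
[cite: CIP1994, §4.4 eq. (4.7) and App. 4.A–4.B] [cite: Spohn2006, Thm 11] -/
def lanford_sectorwiseDuhamelFormula : Prop :=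
  ∀ {ε : ℝ} (hε : 0 < ε) (hε' : ε < 2⁻¹) {β₀ C₀ : ℝ}, 0 < β₀ → 0 < C₀ →
    ∀ f₀ : UnitAddTorus d → EuclideanSpace ℝ d → ℝ, IsLanfordDatum β₀ C₀ f₀ →
      ∀ n, ∀ s ≤ n, ∀ t : ℝ, 0 ≤ t →
        nthMarginal n s (gcEvolved (fun N => Alexander.regHardSphereFlow (d := d) hε hε' N)
          (gcInitial (Torus.geometry d) ε (bgActivity d ε) (uncurry f₀)) t n) =ᵐ[volume]
        (hsHierarchyModel (d := d) hε hε' n).seriesFamily n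
          (fun k => nthMarginal n k (gcInitial (Torus.geometry d) ε (bgActivity d ε) (uncurry f₀) n)) s t

/-- NAMED FACT **(C) — term-by-term convergence of the grand-canonical Duhamel terms to the
Boltzmann Duhamel terms** (CIP 1994, Thm 4.4.1, proof, Step 1; GST 2013, Part III, proof of
Thm 8). For `d ≥ 2` and `β₀, C₀ > 0` there is `T_c > 0` such that for every Lanford datum `f₀`,
every sequence `ε_k → 0⁺` with `ε_k < 1/2`, all `s, n`, every continuous compactly supported
velocity observable `φ`, every compact `K` off the position diagonal and every `δ > 0`: eventually
in `k`, for all `t ∈ [0, T_c]` and `x_s ∈ K`, the velocity averages of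
`Q^{ε_k}_{s,s+n}(t) F_{ε_k}(0)` (`lanfordGCTerm`) and of `Q⁰_{s,s+n}(t) f₀^{⊗(s+n)}`
(`boltzmannDuhamelTerm`) at `x_s` differ by at most `δ`. Input (C) of
`lanford_of_sectorwise_of_termwise` (`LanfordReduction.lean`), verbatim. Users take
`(h : lanford_termwiseConvergence)`.
[cite: CIP1994, §4.4 Thm 4.4.1, proof, Step 1 (pp. 77–86)] [cite: GST2013, Part III, proof of Thm 8 (Ch. 18 §2)] -/
def lanford_termwiseConvergence : Prop :=
  ∀ (_hd : 2 ≤ Fintype.card d) {β₀ C₀ : ℝ}, 0 < β₀ → 0 < C₀ →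
    ∃ T_c > (0 : ℝ), ∀ f₀ : UnitAddTorus d → EuclideanSpace ℝ d → ℝ, IsLanfordDatum β₀ C₀ f₀ →
      ∀ ε : ℕ → ℝ, (∀ k, 0 < ε k) → ∀ hε' : ∀ k, ε k < 2⁻¹, Tendsto ε atTop (𝓝 0) →
        ∀ (s n : ℕ) (φ : (Fin s → EuclideanSpace ℝ d) → ℝ), Continuous φ → HasCompactSupport φ →
          ∀ K ⊆ offDiag (X := UnitAddTorus d) s, IsCompact K → ∀ δ > (0 : ℝ),
            ∀ᶠ k in atTop, ∀ t ∈ Icc 0 T_c, ∀ xs ∈ K,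
              |velocityAverage φ (lanfordGCTerm (d := d) (hε' k) (uncurry f₀) n s t) xs -
                velocityAverage φ (boltzmannDuhamelTerm (Torus.geometry d) n s t
                  (fun j => tensorPow j (uncurry f₀))) xs| ≤ δ

/-- **Assembly (PROVED): `lanford` from its two named inputs (S) and (C)** — this is
`lanford_of_sectorwise_of_termwise` (`LanfordReduction.lean`: majorants `abs_lanfordGCTerm_le`,
measurability, the a.e. representation from (S) via `LanfordGCResummation`, and (C), fed to
`lanford_of_bbgkySide`). Discharging both children discharges `lanford`.
[cite: CIP1994, §4.4 Thm 4.4.1, proof, Steps 1–4 (pp. 77–86)] -/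
theorem lanford_holds_of (hS : lanford_sectorwiseDuhamelFormula (d := d))
    (hC : lanford_termwiseConvergence (d := d)) : lanford (d := d) :=
  lanford_of_sectorwise_of_termwise hS hC

end

end Literature.MathematicalPhysics.KineticTheory
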